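import Literature.RingTheory.Flat.FibrewiseCriterion
import Literature.RingTheory.Flat.FibrewiseCriterionLevel
import Literature.RingTheory.Flat.FibrewiseCriterionFibre
import Literature.RingTheory.Flat.FlatLimitLocal
import Mathlib.RingTheory.FinitePresentation
import HarnessLib

/-!
# Proof of the fibrewise criterion of flatness `Stacks05UV` (Stacks 00MP, 00R7, 05UV)

This file DISCHARGES the named fact `Literature.RingTheory.Flat.Stacks05UV`
(`Literature/RingTheory/Flat/FibrewiseCriterion.lean`; The Stacks Project, Tag 05UV, vendored for
algebras: `(R, 𝔪)` local, `B` of finite type, `B′` finitely presented and flat over `R`,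
`B → B′`, `B′/𝔪B′` flat over `B/𝔪B`, `𝔮′ ⊇ 𝔪B′` ⟹ `B′_{𝔮′}` flat over `B`) by the printed limit
argument of Tags 00R7/05UV on top of the tree's Tag 00R6 (`Idx.exists_flat_atPrime`,
`FlatLimitLocal.lean`), Tag 00R0 (`NoetherianApproximation.lean`) and Tag 00MK / Matsumura 22.3
(`flat_of_le_jacobson`, `LocalCriterion.lean`):

1. `exists_presentation` — presentations `B = R[x₁, …, xₙ]/I` and `B′ = R[x, y]/(F)` with the
   `xᵢ` mapping compatibly, `F ⊇ {g₁, …, g_s} ⊆ I` where the `ḡⱼ` generate the image of `I` in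
   `k[x]` (`k = R/𝔪`; `k[x]` is Noetherian) — this replaces the finite type `B` by the finitely
   presented `C = R[x]/(g)` with the same fibre `C/𝔪C = B/𝔪B`, as in the proof of Tag 05UV.
2. At a level `T` of the absolute Noetherian approximation of `R[x, y]/(F)` (`T ⊆ R` a finitely
   generated subring containing all coefficients, large enough for Tag 00R6 to make
   `P_T = T[x, y]/(F_T)` flat over `T` at `𝔮′`), the Noetherian fibrewise criterion
   (`flat_localization_of_flat_of_fibre`, Tag 00MP) makes `(P_T)_{𝔮′_T}` flat over
   `C_T = T[x]/(g_T)`: its fibre hypothesis holds because `B′/𝔪B′ = k ⊗_T P_T`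
   (`isPushout_quotient_comp`) is flat over `B/𝔪B`, which is flat over `C_T/𝔭C_T`
   (`flat_of_fibre_generators`).
3. Base change along `C_T → C = R ⊗_T C_T` and localization give `B′_{𝔮′}` flat over `C`
   (`flat_localization_of_isPushout`), hence over its quotient `B`
   (`flat_of_flat_of_surjective`).

## References

* The Stacks Project, Tags 05UV, 00R7, 00MP, 00R6, 00R0. [StacksProject]
-/

universe u

open TensorProduct MvPolynomial IsLocalRing

noncomputable section

namespace Literature.RingTheory.Flat

/-! ### Step 1: compatible presentations -/

/-- **Compatible presentations of `B → B′`.** For `B` of finite type and `B′` of finite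
presentation over `R`, an `R`-algebra map `B → B′` and an ideal `𝔪 ⊆ R` with `R/𝔪` a field, there
are: a surjection `π : R[x₁, …, xₙ] → B`; polynomials `g₁, …, g_s ∈ Ker π` whose reductions
generate the image of `Ker π` in `(R/𝔪)[x]`; an injection `emb` of the variables `x` into the
variables of a presentation `B′ ≅ R[x, y]/(F₁, …, F_m)` under which `xᵢ ↦` the image of `π(xᵢ)`,
with every `g_l` (renamed) among the `Fⱼ`. (The kernel of `R[x, y] → B′` is finitely generated
for any finite set of generators, Mathlib's `Algebra.FinitePresentation.ker_fG_of_surjective`.)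
[cite: StacksProject, Tag 05UV (proof)] -/
theorem exists_presentation (R B B' : Type u) [CommRing R] [CommRing B] [CommRing B']
    [Algebra R B] [Algebra R B'] [Algebra B B'] [IsScalarTower R B B'] [Algebra.FiniteType R B]
    [Algebra.FinitePresentation R B'] (𝔪 : Ideal R) [𝔪.IsMaximal] :
    ∃ (n N s m : ℕ) (emb : Fin n → Fin N) (g : Fin s → MvPolynomial (Fin n) R)
      (F : Fin m → MvPolynomial (Fin N) R) (π : MvPolynomial (Fin n) R →ₐ[R] B)
      (e : Pinf F ≃ₐ[R] B'),
      Function.Injective emb ∧ Function.Surjective π ∧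
      (∀ l, ∃ i, F i = MvPolynomial.rename emb (g l)) ∧ (∀ l, π (g l) = 0) ∧
      (∀ i, e (Pinf.mk (X (emb i))) = algebraMap B B' (π (X i))) ∧
      (RingHom.ker (π : MvPolynomial (Fin n) R →+* B)).map
          (MvPolynomial.map (Ideal.Quotient.mk 𝔪)) =
        Ideal.span (Set.range fun l => MvPolynomial.map (Ideal.Quotient.mk 𝔪) (g l)) := by
  classical
  -- generators of `B` and of `B′`
  obtain ⟨n, π, hπ⟩ := Algebra.FiniteType.iff_quotient_mvPolynomial''.mp ‹Algebra.FiniteType R B›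
  obtain ⟨p₀, ρ, hρ, -⟩ := Algebra.FinitePresentation.out (R := R) (A := B')
  -- the presentation of `B′` on the generators `π(xᵢ)` and `ρ(yⱼ)`
  let v : Fin (n + p₀) → B' :=
    Fin.addCases (fun i => algebraMap B B' (π (X i))) (fun j => ρ (X j))
  let Φ : MvPolynomial (Fin (n + p₀)) R →ₐ[R] B' := MvPolynomial.aeval v
  have hvl : ∀ i, v (Fin.castAdd p₀ i) = algebraMap B B' (π (X i)) := fun i =>
    Fin.addCases_left i
  have hvr : ∀ j, v (Fin.natAdd n j) = ρ (X j) := fun j =>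
    Fin.addCases_right j
  have hΦρ : ∀ f, Φ (MvPolynomial.rename (Fin.natAdd n) f) = ρ f := by
    intro f
    rw [MvPolynomial.aeval_rename]
    have hρ' : ρ = MvPolynomial.aeval (v ∘ Fin.natAdd n) := by
      refine MvPolynomial.algHom_ext fun j => ?_
      rw [MvPolynomial.aeval_X, Function.comp_apply, hvr]
    rw [hρ']
  have hΦ : Function.Surjective Φ := fun b => by
    obtain ⟨f, rfl⟩ := hρ b
    exact ⟨_, hΦρ f⟩
  have hΦx : ∀ i, Φ (X (Fin.castAdd p₀ i)) = algebraMap B B' (π (X i)) := fun i => by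
    rw [MvPolynomial.aeval_X, hvl]
  have hΦl : ∀ f : MvPolynomial (Fin n) R,
      Φ (MvPolynomial.rename (Fin.castAdd p₀) f) = algebraMap B B' (π f) := by
    intro f
    rw [MvPolynomial.aeval_rename]
    have h' : MvPolynomial.aeval (v ∘ Fin.castAdd p₀) = (IsScalarTower.toAlgHom R B B').comp π := by
      refine MvPolynomial.algHom_ext fun i => ?_
      rw [MvPolynomial.aeval_X, Function.comp_apply, hvl, AlgHom.comp_apply]
      rfl
    rw [h']
    rfl
  -- the kernel of `Φ` is finitely generated
  obtain ⟨m₀, F₀, hF₀⟩ := Submodule.fg_iff_exists_fin_generating_family.mp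
    (Algebra.FinitePresentation.ker_fG_of_surjective Φ hΦ)
  rw [AlgHom.toRingHom_eq_coe] at hF₀
  -- generators of the fibre ideal, lifted to `Ker π`
  letI := Ideal.Quotient.field 𝔪
  let mkk : MvPolynomial (Fin n) R →+* MvPolynomial (Fin n) (R ⧸ 𝔪) :=
    MvPolynomial.map (Ideal.Quotient.mk 𝔪)
  have hmkk : Function.Surjective mkk := MvPolynomial.map_surjective _ Ideal.Quotient.mk_surjective
  let Ibar : Ideal (MvPolynomial (Fin n) (R ⧸ 𝔪)) :=
    (RingHom.ker (π : MvPolynomial (Fin n) R →+* B)).map mkk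
  obtain ⟨s, gbar, hgbar⟩ := Submodule.fg_iff_exists_fin_generating_family.mp
    (IsNoetherian.noetherian Ibar)
  have hg' : ∀ l, ∃ g, g ∈ RingHom.ker (π : MvPolynomial (Fin n) R →+* B) ∧ mkk g = gbar l :=
    fun l => by
      have hl : gbar l ∈ Ibar := hgbar ▸ Ideal.subset_span ⟨l, rfl⟩
      exact (Ideal.mem_map_iff_of_surjective mkk hmkk).mp hl
  choose g hgker hgmap using hg'
  -- the relations `F`
  let F : Fin (m₀ + s) → MvPolynomial (Fin (n + p₀)) R :=
    Fin.append F₀ fun l => MvPolynomial.rename (Fin.castAdd p₀) (g l)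
  have hFspan : Ideal.span (Set.range F) = RingHom.ker (Φ : MvPolynomial (Fin (n + p₀)) R →+* B') := by
    apply le_antisymm
    · rw [Ideal.span_le]
      rintro _ ⟨i, rfl⟩
      refine Fin.addCases (motive := fun i => F i ∈ _) (fun i => ?_) (fun l => ?_) i
      · change Fin.append F₀ _ (Fin.castAdd s i) ∈ _
        rw [Fin.append_left, SetLike.mem_coe, ← hF₀]
        exact Submodule.subset_span ⟨i, rfl⟩
      · change Fin.append F₀ _ (Fin.natAdd m₀ l) ∈ _
        rw [Fin.append_right, SetLike.mem_coe, RingHom.mem_ker]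
        change Φ (MvPolynomial.rename (Fin.castAdd p₀) (g l)) = 0
        rw [hΦl, show π (g l) = 0 from hgker l, map_zero]
    · rw [← hF₀, Submodule.span_le]
      rintro _ ⟨i, rfl⟩
      exact Ideal.subset_span ⟨Fin.castAdd s i, Fin.append_left F₀ _ i⟩
  let e : Pinf F ≃ₐ[R] B' :=
    (Ideal.quotientEquivAlgOfEq R hFspan).trans (Ideal.quotientKerAlgEquivOfSurjective hΦ)
  refine ⟨n, n + p₀, s, m₀ + s, Fin.castAdd p₀, g, F, π, e, Fin.castAdd_injective _ _, hπ,
    fun l => ⟨Fin.natAdd m₀ l, Fin.append_right F₀ _ l⟩, fun l => hgker l, fun i => ?_, ?_⟩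
  · change Ideal.quotientKerAlgEquivOfSurjective hΦ
      (Ideal.quotientEquivAlgOfEq R hFspan (Ideal.Quotient.mk _ (X (Fin.castAdd p₀ i)))) = _
    rw [Ideal.quotientEquivAlgOfEq_mk]
    exact (Ideal.quotientKerAlgEquivOfSurjective_mk hΦ _).trans (hΦx i)
  · change Ibar = _
    rw [← hgbar]
    congr 1
    ext x
    simp only [Set.mem_range]
    constructor
    · rintro ⟨l, rfl⟩
      exact ⟨l, hgmap l⟩
    · rintro ⟨l, rfl⟩
      exact ⟨l, (hgmap l).symm⟩

/-! ### Steps 2–3: the limit argument -/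

set_option maxHeartbeats 1600000 in
set_option synthInstance.maxHeartbeats 200000 in
/-- **The fibrewise criterion of flatness, `Stacks05UV`** (The Stacks Project, Tag 05UV with
Tags 00R7, 00MP; EGA IV₃ 11.3.10), DISCHARGED: see the module docstring for the architecture of
the proof. [cite: StacksProject, Tag 05UV] -/
theorem Stacks05UV_holds : Stacks05UV := by
  intro R B B' _ _ _ _ _ _ _ _ hft hfp hflat hfib q' _ hq'
  classical
  let 𝔪 := maximalIdeal R
  let k := R ⧸ 𝔪
  letI : Field k := Ideal.Quotient.field 𝔪
  obtain ⟨n, N, s, m, emb, g, F, π, e, hemb, hπ, hgF, hπg, he, hfibre⟩ :=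
    exists_presentation R B B' 𝔪
  let eh : Pinf F →+* B' := (e : Pinf F ≃ₐ[R] B').toRingEquiv.toRingHom
  -- Step 2a: the level `T` (Tag 00R6)
  haveI : Module.Flat R (Pinf F) := Module.Flat.of_linearEquiv e.toLinearEquiv
  let 𝔮 : Ideal (Pinf F) := q'.comap eh
  haveI : 𝔮.IsPrime := Ideal.IsPrime.comap eh
  obtain ⟨W, hW⟩ := Idx.exists_flat_atPrime 𝔮 (Idx.init F)
  let mu : Idx F := (Idx.init F).adjoin W
  letI := Idx.algebraOfLE ((Idx.init F).le_adjoin W)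
  haveI := Idx.isScalarTower_of_le ((Idx.init F).le_adjoin W)
  haveI hflatT : Module.Flat mu.T (Localization.AtPrime (mu.qT 𝔮)) :=
    hW mu ((Idx.init F).subset_adjoin W)
  haveI : IsNoetherianRing mu.T := mu.isNoetherianRing
  -- the primes `Q = 𝔮′ ∩ P_T ⊇ 𝔭 = 𝔪 ∩ T`
  let Q : Ideal mu.P := mu.qT 𝔮
  let p : Ideal mu.T := mu.pT 𝔮
  have hQ : Q.comap (algebraMap mu.T mu.P) = p := Idx.comap_qT 𝔮 mu
  have h𝔮R : 𝔮.comap (algebraMap R (Pinf F)) = 𝔪 := by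
    have h1 : 𝔮.comap (algebraMap R (Pinf F)) = q'.comap (algebraMap R B') := by
      change (q'.comap eh).comap _ = _
      rw [Ideal.comap_comap]
      congr 1
      ext r
      exact e.commutes r
    rw [h1]
    refine ((IsLocalRing.maximalIdeal.isMaximal R).eq_of_le
      (Ideal.IsPrime.ne_top inferInstance) (Ideal.map_le_iff_le_comap.mp hq')).symm
  have hp : p = 𝔪.comap (algebraMap mu.T R) := by
    change mu.pT 𝔮 = _
    rw [Idx.pT_eq_comap_pA]
    change (𝔮.comap (algebraMap R (Pinf F))).comap _ = _
    rw [h𝔮R]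
  have hk : ∀ t : mu.T, algebraMap mu.T k t = 0 ↔ t ∈ p := fun t => by
    rw [hp, Ideal.mem_comap, IsScalarTower.algebraMap_apply mu.T R k,
      Ideal.Quotient.algebraMap_eq, Ideal.Quotient.eq_zero_iff_mem]
  -- Step 2b: `P_T → B′` and `B′ = R ⊗_T P_T`
  haveI hP : Algebra.IsPushout mu.T R mu.P (Pinf F) := Idx.isPushout_Pinf mu
  let ε : mu.P →ₐ[mu.T] B' :=
    ((e : Pinf F ≃ₐ[R] B').toAlgHom.restrictScalars mu.T).comp mu.toPinf
  letI : Algebra mu.P B' := ε.toRingHom.toAlgebra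
  haveI : IsScalarTower mu.T mu.P B' :=
    IsScalarTower.of_algebraMap_eq (R := mu.T) (S := mu.P) (A := B') fun t => (ε.commutes t).symm
  haveI : Algebra.IsPushout mu.T R mu.P B' :=
    Algebra.IsPushout.of_equiv (h := hP) (e : Pinf F ≃ₐ[R] B') (RingHom.ext fun _ => rfl)
  have hQq' : Q = q'.comap (algebraMap mu.P B') := by
    change (q'.comap eh).comap _ = _
    rw [Ideal.comap_comap]
    rfl
  -- Step 2c: `C_T = T[x]/(g_T)` (the level `T` of the approximation of `C = R[x]/(g)`)
  have hcoef : ∀ l, ((g l).coeffs : Set R) ⊆ (mu.T : Set R) := by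
    intro l c hc
    obtain ⟨i, hi⟩ := hgF l
    obtain ⟨d, hd, rfl⟩ := MvPolynomial.mem_coeffs_iff.mp hc
    apply mu.coeffs_subset i
    rw [hi, Finset.mem_coe]
    have hne : (g l).coeff d ≠ 0 := MvPolynomial.mem_support_iff.mp hd
    rw [← MvPolynomial.coeff_rename_mapDomain emb hemb (g l) d] at hne ⊢
    exact MvPolynomial.coeff_mem_coeffs _ hne
  let muC : Idx g := ⟨mu.T, mu.fg, hcoef⟩
  let C := muC.P
  let Cinf := Pinf g
  letI : Algebra mu.T C := inferInstanceAs (Algebra muC.T muC.P)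
  haveI : IsScalarTower mu.T C Cinf := Idx.isScalarTower_P_Pinf muC
  haveI : Algebra.IsPushout mu.T R C Cinf := Idx.isPushout_Pinf muC
  haveI : IsNoetherianRing C := Idx.isNoetherianRing_P muC
  -- `θ : C_T → P_T`, `xᵢ ↦ xᵢ`
  have hθJ : ∀ a ∈ muC.J, (mu.mkP.comp (MvPolynomial.rename emb)) a = 0 := by
    have hle : muC.J ≤
        RingHom.ker (mu.mkP.comp (MvPolynomial.rename emb) :
          MvPolynomial (Fin n) mu.T →+* mu.P) := by
      change Ideal.span _ ≤ _
      rw [Ideal.span_le]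
      rintro _ ⟨l, rfl⟩
      obtain ⟨i, hi⟩ := hgF l
      rw [SetLike.mem_coe, RingHom.mem_ker]
      change mu.mkP (MvPolynomial.rename emb (muC.res l)) = 0
      have hren : MvPolynomial.rename emb (muC.res l) = mu.res i := by
        apply MvPolynomial.map_injective (algebraMap mu.T R) mu.algebraMap_injective
        have hres : MvPolynomial.map (algebraMap mu.T R) (muC.res l) = g l := muC.map_res l
        rw [MvPolynomial.map_rename, hres, ← hi, Idx.map_res]
      rw [hren, Idx.mkP_res]
    exact fun a ha => hle ha
  let θ : C →ₐ[mu.T] mu.P := Ideal.Quotient.liftₐ muC.J (mu.mkP.comp (MvPolynomial.rename emb)) hθJ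
  letI : Algebra C mu.P := θ.toRingHom.toAlgebra
  haveI : IsScalarTower mu.T C mu.P :=
    IsScalarTower.of_algebraMap_eq (R := mu.T) (S := C) (A := mu.P) fun t => (θ.commutes t).symm
  -- `θ∞ : C → B`, `xᵢ ↦ π xᵢ` (onto), and the structures `C_T → C → B → B′`
  have hπJ : ∀ a ∈ Ideal.span (Set.range g), π a = 0 := by
    have hle : Ideal.span (Set.range g) ≤ RingHom.ker (π : MvPolynomial (Fin n) R →+* B) := by
      rw [Ideal.span_le]
      rintro _ ⟨l, rfl⟩
      rw [SetLike.mem_coe, RingHom.mem_ker]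
      exact hπg l
    exact fun a ha => hle ha
  let θinf : Cinf →ₐ[R] B := Ideal.Quotient.liftₐ (Ideal.span (Set.range g)) π hπJ
  have hθinf_mk : ∀ f, θinf (Pinf.mk f) = π f := fun f => Ideal.Quotient.lift_mk _ _ _
  have hθinf : Function.Surjective θinf := fun b => by
    obtain ⟨f, rfl⟩ := hπ b
    exact ⟨Pinf.mk f, hθinf_mk f⟩
  letI : Algebra Cinf B := θinf.toRingHom.toAlgebra
  haveI : IsScalarTower R Cinf B :=
    IsScalarTower.of_algebraMap_eq (R := R) (S := Cinf) (A := B) fun r => (θinf.commutes r).symm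
  letI : Algebra Cinf B' := ((algebraMap B B').comp (θinf : Cinf →+* B)).toAlgebra
  haveI : IsScalarTower Cinf B B' :=
    IsScalarTower.of_algebraMap_eq (R := Cinf) (S := B) (A := B') fun _ => rfl
  haveI : IsScalarTower R Cinf B' :=
    IsScalarTower.of_algebraMap_eq (R := R) (S := Cinf) (A := B') fun r => by
      change algebraMap R B' r = algebraMap B B' (θinf (algebraMap R Cinf r))
      rw [θinf.commutes, ← IsScalarTower.algebraMap_apply]
  letI : Algebra C B := ((algebraMap Cinf B).comp (algebraMap C Cinf)).toAlgebra
  haveI : IsScalarTower C Cinf B :=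
    IsScalarTower.of_algebraMap_eq (R := C) (S := Cinf) (A := B) fun _ => rfl
  letI : Algebra C B' := ((algebraMap Cinf B').comp (algebraMap C Cinf)).toAlgebra
  haveI : IsScalarTower C Cinf B' :=
    IsScalarTower.of_algebraMap_eq (R := C) (S := Cinf) (A := B') fun _ => rfl
  haveI : IsScalarTower C B B' :=
    IsScalarTower.of_algebraMap_eq (R := C) (S := B) (A := B') fun _ => rfl
  have hTCinf : ∀ t : mu.T, algebraMap C Cinf (algebraMap mu.T C t) = algebraMap R Cinf (t : R) :=
    fun t => by
      rw [← IsScalarTower.algebraMap_apply mu.T C Cinf]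
      rfl
  haveI : IsScalarTower mu.T C B :=
    IsScalarTower.of_algebraMap_eq (R := mu.T) (S := C) (A := B) fun t => by
      have e1 : algebraMap C B (algebraMap mu.T C t) =
          θinf (algebraMap C Cinf (algebraMap mu.T C t)) := rfl
      rw [e1, hTCinf, θinf.commutes, IsScalarTower.algebraMap_apply mu.T R B]
      rfl
  haveI : IsScalarTower mu.T B B' :=
    IsScalarTower.of_algebraMap_eq (R := mu.T) (S := B) (A := B') fun t => by
      change algebraMap R B' (t : R) = algebraMap B B' (algebraMap R B (t : R))
      exact IsScalarTower.algebraMap_apply R B B' _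
  haveI : IsScalarTower mu.T C B' :=
    IsScalarTower.of_algebraMap_eq (R := mu.T) (S := C) (A := B') fun t => by
      rw [IsScalarTower.algebraMap_apply mu.T B B', IsScalarTower.algebraMap_apply mu.T C B,
        ← IsScalarTower.algebraMap_apply C B B']
  haveI : IsScalarTower mu.T Cinf B' :=
    IsScalarTower.of_algebraMap_eq (R := mu.T) (S := Cinf) (A := B') fun t => by
      rw [IsScalarTower.algebraMap_apply mu.T R B', IsScalarTower.algebraMap_apply R Cinf B']
      rfl
  -- the two routes `C_T → B′` agree (check on the generators `xᵢ`)
  haveI : IsScalarTower C mu.P B' := by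
    refine IsScalarTower.of_algebraMap_eq' (R := C) (S := mu.P) (A := B') ?_
    have h : IsScalarTower.toAlgHom mu.T C B' = (IsScalarTower.toAlgHom mu.T mu.P B').comp θ := by
      refine Ideal.Quotient.algHom_ext _ (MvPolynomial.algHom_ext fun j => ?_)
      simp only [AlgHom.comp_apply, Ideal.Quotient.mkₐ_eq_mk]
      have e1 : algebraMap C B' (muC.mkP (X j)) =
          algebraMap B B' (θinf (muC.toPinf (muC.mkP (X j)))) := rfl
      have e2 : algebraMap mu.P B' (θ (muC.mkP (X j))) =
          e (mu.toPinf (mu.mkP (MvPolynomial.rename emb (X j)))) := rfl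
      change algebraMap C B' (muC.mkP (X j)) = algebraMap mu.P B' (θ (muC.mkP (X j)))
      rw [e1, e2, Idx.toPinf_mkP, MvPolynomial.map_X, MvPolynomial.rename_X, Idx.toPinf_mkP,
        MvPolynomial.map_X, hθinf_mk, ← he]
    exact congrArg AlgHom.toRingHom h
  -- `B′ = C ⊗_{C_T} P_T`
  haveI : Algebra.IsPushout mu.T C R Cinf := Algebra.IsPushout.symm inferInstance
  haveI : Algebra.IsPushout mu.T mu.P R B' := Algebra.IsPushout.symm inferInstance
  haveI : Algebra.IsPushout C mu.P Cinf B' :=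
    (Algebra.IsPushout.comp_iff mu.T C R Cinf (T := mu.P) (T' := B')).mp inferInstance
  haveI : Algebra.IsPushout C Cinf mu.P B' := Algebra.IsPushout.symm inferInstance
  -- Step 2d: the fibres `Λ₀ = B/𝔪B`, `E = B′/𝔪B′`
  let 𝔪B : Ideal B := 𝔪.map (algebraMap R B)
  let Λ₀ := B ⧸ 𝔪B
  let E := B' ⧸ 𝔪B.map (algebraMap B B')
  haveI : Module.Flat Λ₀ E :=
    Module.Flat.of_linearEquiv
      (Algebra.TensorProduct.quotIdealMapEquivQuotTensor B' 𝔪B).toLinearEquiv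
  have h𝔪E : 𝔪 ≤ (𝔪B.map (algebraMap B B')).comap (algebraMap R B') := fun r hr => by
    rw [Ideal.mem_comap, IsScalarTower.algebraMap_apply R B B']
    exact Ideal.mem_map_of_mem _ (Ideal.mem_map_of_mem _ hr)
  letI : Algebra k E := Ideal.Quotient.algebraQuotientOfLEComap h𝔪E
  haveI : IsScalarTower R k E := IsScalarTower.of_algebraMap_eq (R := R) (S := k) (A := E) fun r => rfl
  haveI : IsScalarTower mu.T k E :=
    IsScalarTower.of_algebraMap_eq (R := mu.T) (S := k) (A := E) fun t => rfl
  haveI : IsScalarTower k Λ₀ E :=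
    IsScalarTower.of_algebraMap_eq (R := k) (S := Λ₀) (A := E) fun a => by
      obtain ⟨r, rfl⟩ := Ideal.Quotient.mk_surjective a
      change Ideal.Quotient.mk _ (algebraMap R B' r) =
        Ideal.Quotient.mk _ (algebraMap B B' (algebraMap R B r))
      rw [← IsScalarTower.algebraMap_apply]
  haveI : Algebra.IsPushout mu.T k mu.P E := isPushout_quotient_comp 𝔪
  -- `Λ = C_T/𝔭C_T → Λ₀ → E`
  let Λ := C ⧸ p.map (algebraMap mu.T C)
  have hpΛ₀ : ∀ c ∈ p.map (algebraMap mu.T C), algebraMap C B c ∈ 𝔪B := by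
    intro c hc
    refine Submodule.span_induction ?_ ?_ ?_ ?_ hc
    · rintro _ ⟨t, ht, rfl⟩
      have ht' : (t : mu.T) ∈ 𝔪.comap (algebraMap mu.T R) := hp ▸ (ht : (t : mu.T) ∈ p)
      rw [← IsScalarTower.algebraMap_apply, IsScalarTower.algebraMap_apply mu.T R B]
      exact Ideal.mem_map_of_mem _ ht'
    · rw [map_zero]
      exact Submodule.zero_mem _
    · intro x y _ _ hx hy
      rw [map_add]
      exact Submodule.add_mem _ hx hy
    · intro a x _ hx
      rw [smul_eq_mul, map_mul]
      exact Ideal.mul_mem_left _ _ hx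
  have hpE : ∀ c ∈ p.map (algebraMap mu.T C), algebraMap C B' c ∈ 𝔪B.map (algebraMap B B') := by
    intro c hc
    rw [IsScalarTower.algebraMap_apply C B B']
    exact Ideal.mem_map_of_mem _ (hpΛ₀ c hc)
  letI : Algebra Λ Λ₀ :=
    Ideal.Quotient.algebraQuotientOfLEComap (R := C) (A := B) (p := p.map (algebraMap mu.T C))
      (P := 𝔪B) fun c hc => hpΛ₀ c hc
  letI : Algebra Λ E :=
    Ideal.Quotient.algebraQuotientOfLEComap (R := C) (A := B') (p := p.map (algebraMap mu.T C))
      (P := 𝔪B.map (algebraMap B B')) fun c hc => hpE c hc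
  haveI : IsScalarTower C Λ Λ₀ := IsScalarTower.of_algebraMap_eq (R := C) (S := Λ) (A := Λ₀) fun _ => rfl
  haveI : IsScalarTower C Λ E := IsScalarTower.of_algebraMap_eq (R := C) (S := Λ) (A := E) fun _ => rfl
  haveI : IsScalarTower Λ Λ₀ E :=
    IsScalarTower.of_algebraMap_eq (R := Λ) (S := Λ₀) (A := E) fun a => by
      obtain ⟨c, rfl⟩ := Ideal.Quotient.mk_surjective a
      rfl
  haveI : IsScalarTower mu.T k Λ₀ :=
    IsScalarTower.of_algebraMap_eq (R := mu.T) (S := k) (A := Λ₀) fun t => rfl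
  haveI : IsScalarTower mu.T C Λ₀ :=
    IsScalarTower.of_algebraMap_eq (R := mu.T) (S := C) (A := Λ₀) fun t => by
      change Ideal.Quotient.mk 𝔪B (algebraMap mu.T B t) =
        Ideal.Quotient.mk 𝔪B (algebraMap C B (algebraMap mu.T C t))
      rw [← IsScalarTower.algebraMap_apply mu.T C B]
  -- Step 2e: `Λ₀` is flat over `Λ` (the `ḡⱼ` generate the fibre ideal)
  let gT : Fin s → MvPolynomial (Fin n) mu.T := muC.res
  have hgT : ∀ l, MvPolynomial.map (algebraMap mu.T R) (gT l) = g l := fun l => muC.map_res l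
  have hmapg : ∀ l, MvPolynomial.map (algebraMap mu.T k) (gT l) =
      MvPolynomial.map (Ideal.Quotient.mk 𝔪) (g l) := fun l => by
    rw [IsScalarTower.algebraMap_eq mu.T R k, ← MvPolynomial.map_map, hgT]
    rfl
  let mkC : MvPolynomial (Fin n) mu.T →ₐ[mu.T] C := muC.mkP
  have hβ : (MvPolynomial.eval₂Hom (algebraMap k Λ₀) fun i => algebraMap C Λ₀ (mkC (X i))).comp
      (MvPolynomial.map (Ideal.Quotient.mk 𝔪)) =
        (Ideal.Quotient.mk 𝔪B).comp (π : MvPolynomial (Fin n) R →+* B) := by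
    refine MvPolynomial.ringHom_ext (fun r => ?_) (fun i => ?_)
    · rw [RingHom.comp_apply, RingHom.comp_apply, MvPolynomial.map_C, MvPolynomial.eval₂Hom_C]
      change Ideal.Quotient.mk 𝔪B (algebraMap R B r) = Ideal.Quotient.mk 𝔪B (π (MvPolynomial.C r))
      rw [← MvPolynomial.algebraMap_eq, π.commutes]
    · rw [RingHom.comp_apply, RingHom.comp_apply, MvPolynomial.map_X, MvPolynomial.eval₂Hom_X']
      change Ideal.Quotient.mk 𝔪B (θinf (muC.toPinf (muC.mkP (X i)))) =
        Ideal.Quotient.mk 𝔪B (π (X i))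
      rw [Idx.toPinf_mkP, MvPolynomial.map_X, hθinf_mk]
  have hgen : Function.Surjective
      (MvPolynomial.eval₂Hom (algebraMap k Λ₀) fun i => algebraMap C Λ₀ (mkC (X i))) := by
    intro y
    obtain ⟨b, rfl⟩ := Ideal.Quotient.mk_surjective y
    obtain ⟨f, rfl⟩ := hπ b
    exact ⟨MvPolynomial.map (Ideal.Quotient.mk 𝔪) f, DFunLike.congr_fun hβ f⟩
  have hker : RingHom.ker (MvPolynomial.eval₂Hom (algebraMap k Λ₀) fun i =>
        algebraMap C Λ₀ (mkC (X i))) ≤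
      Ideal.span (Set.range fun l => MvPolynomial.map (algebraMap mu.T k) (gT l)) := by
    intro fbar hf
    obtain ⟨f, rfl⟩ :=
      MvPolynomial.map_surjective (Ideal.Quotient.mk 𝔪) Ideal.Quotient.mk_surjective fbar
    have h1 : π f ∈ 𝔪B := by
      rw [← Ideal.Quotient.eq_zero_iff_mem]
      rw [RingHom.mem_ker] at hf
      rw [← hf]
      exact (DFunLike.congr_fun hβ f).symm
    have h2 : 𝔪B = (𝔪.map (algebraMap R (MvPolynomial (Fin n) R))).map
        (π : MvPolynomial (Fin n) R →+* B) := by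
      change 𝔪.map (algebraMap R B) = _
      rw [Ideal.map_map, (π : MvPolynomial (Fin n) R →ₐ[R] B).comp_algebraMap]
    rw [h2] at h1
    obtain ⟨m', hm', hπm'⟩ :=
      (Ideal.mem_map_iff_of_surjective (π : MvPolynomial (Fin n) R →+* B) hπ).mp h1
    have h3 : f - m' ∈ RingHom.ker (π : MvPolynomial (Fin n) R →+* B) := by
      rw [RingHom.mem_ker, map_sub, sub_eq_zero]
      exact hπm'.symm
    have h4 : MvPolynomial.map (Ideal.Quotient.mk 𝔪) m' = 0 := by
      rw [← RingHom.mem_ker, MvPolynomial.ker_map, Ideal.mk_ker]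
      rwa [MvPolynomial.algebraMap_eq] at hm'
    have h5 : MvPolynomial.map (Ideal.Quotient.mk 𝔪) f =
        MvPolynomial.map (Ideal.Quotient.mk 𝔪) (f - m') := by
      rw [map_sub, h4, sub_zero]
    have h6 : MvPolynomial.map (Ideal.Quotient.mk 𝔪) (f - m') ∈
        (RingHom.ker (π : MvPolynomial (Fin n) R →+* B)).map
          (MvPolynomial.map (Ideal.Quotient.mk 𝔪)) := Ideal.mem_map_of_mem _ h3
    rw [hfibre] at h6
    have hspan : (Set.range fun l => MvPolynomial.map (algebraMap mu.T k) (gT l)) =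
        Set.range fun l => MvPolynomial.map (Ideal.Quotient.mk 𝔪) (g l) :=
      congrArg Set.range (funext hmapg)
    rw [h5, hspan]
    exact h6
  haveI : Module.Flat Λ Λ₀ :=
    flat_of_fibre_generators p hk gT mkC muC.mkP_surjective (fun l => muC.mkP_res l) hgen hker
  haveI : Module.Flat Λ E := Module.Flat.trans Λ Λ₀ E
  -- Step 2f: the Noetherian fibrewise criterion at level `T` (Tag 00MP)
  haveI : Module.Flat C (Localization.AtPrime Q) :=
    flat_localization_of_flat_of_fibre (T := mu.T) (C := C) (P := mu.P) p Q hQ hk E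
  -- Step 3: going up to `B′_{𝔮′}` over `C`, then over `B = C/Ker`
  haveI : Module.Flat Cinf (Localization.AtPrime q') :=
    flat_localization_of_isPushout (C₀ := C) (C := Cinf) Q q' hQq'
  exact flat_of_flat_of_surjective (R := Cinf) (S := B) hθinf (Localization.AtPrime q')

end Literature.RingTheory.Flat

end
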